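import Summits.SmoothPoincare4.SmoothPoincare4.Theorems.ConvexBisectionAcyclicBisectionExistsDualDataHandle
import Summits.SmoothPoincare4.SmoothPoincare4.Theorems.ConvexBisectionAcyclicBisectionExistsPushedPrefixPush
import HarnessLib

/-!
# The dual multi-attachment data, III: the stretched `W`-piece `E`
(helper file 3 of the wave-5 brick T3b (iv) "the dual multi-attachment data `D₂` on the complement
piece `W₂`" for stub `stub_T3_dualPresentation` (T3), line `modp-braid-orbits`, crux
`ConvexBisection.AcyclicBisectionExists`, item stmt-SmoothPoincare4-10508; lead c5, worker X1)

Sequel of `…DualDataHandle.lean`.  For a finite family `g : ι' → HandleAttachingMap 3 2 W` of attaching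
maps on `W` with pairwise disjoint ranges which, read in Milnor's gluing `M' = X ∪_Ψ W`, are the dual
vectors of the glued handle charts of the suffix handles `f j`,

  (HT) `Θ_{f j} (dualVec a κ δ y) = j_N (g j y)` for all `y ∈ T`

(for the dual family `g j = dualMap … (f j)` this is `gluedHandleChart_dualVec`, file I), the `W`-piece
of the dual multi-attachment data is, as a map into `M'`, the STRETCH (V5-REPORT §2)

  `E w = Θ_{f j} (𝓕 (α y))` if `w = g j y`, `y ∈ T ∖ S`;   `E w = j_N w` off the tubes.

* §1 `exists_extension` — such an `E : W → M'` exists; on the roof shells `‖y_λ‖² < 1/4` of the tubes it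
  is `j_N` (F-top), hence `E = j_N` at every point all of whose tube coordinates are shallow
  (`extension_eq_jN_of_shallow`); the shallow set is open (`isOpen_shallowSet`).
* §2 `E` is an immersion at every point off the attaching circles (`isImmersionAt_extension`: `= j_N`
  near shallow points; on the tubes the tube piece `K̃ⱼ` of file II transported along the open embedding
  `g j`) and injective off the circles (`injOn_extension`).

Everything here is proved; no named facts, no definitions.

## References
* J. Milnor, *Lectures on the h-cobordism theorem* (1965), §3 (dual handles; `W ∪ ∂W × I ≅ W`). [MilnorHCobordism1965]
* A. A. Kosinski, *Differential Manifolds* (1993), VI §6. [Kosinski1993]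
* J. M. Lee, *Introduction to Smooth Manifolds* (2013), Prop. 5.22. [LeeSmoothManifolds2013]
-/

noncomputable section

-- the prescribed namespace `Summit.<P>.<Sub>.…` duplicates `SmoothPoincare4` (P = Sub)
set_option linter.dupNamespace false

open scoped Manifold ContDiff Topology

namespace Summit.SmoothPoincare4.SmoothPoincare4.Theorems.AcyclicBisectionExists.ModpBraidOrbits

open Set Function Metric Filter Topology
open Literature.Topology.FourManifolds Literature.Topology.FourManifolds.HandleAttachingMap

section Extension

variable {B : Type} [TopologicalSpace B] [T2Space B] [ChartedSpace (EuclideanHalfSpace 4) B]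
  {ι : Type} [Finite ι] {h : ι → HandleAttachingMap 3 2 B}
  {X : Type} [TopologicalSpace X] [ChartedSpace (EuclideanHalfSpace 4) X] [IsManifold (𝓡∂ 4) ∞ X]
  (D : MultiAttachmentData h (𝓡∂ 4) X) {ι' : Type} (f : ι' → ι) {bX : BoundaryData (𝓡∂ 4) X (𝓡 3)}
  {W : Type} [TopologicalSpace W] [ChartedSpace (EuclideanHalfSpace 4) W]
  [IsManifold (𝓡∂ 4) ∞ W] {bW : BoundaryData (𝓡∂ 4) W (𝓡 3)} [Nonempty bX.carrier]
  (G : BoundaryGlueData bX bW) {a κ δ : ℝ} (g : ι' → HandleAttachingMap 3 2 W)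

/-! ### §1 The stretch `E` -/

/-- **THE STRETCHED `W`-PIECE `E : W → M'`** exists: `E (g j y) = Θ_{f j} (𝓕 (α y))` on the tubes off the
attaching spheres, `E = j_N` off the tubes (well defined by disjointness of the tube ranges and
injectivity of the attaching maps). [cite: MilnorHCobordism1965, §3] -/
theorem exists_extension (hdisj : Pairwise fun i j => Disjoint (range (g i).toFun) (range (g j).toFun)) :
    ∃ E : W → G.d₂.Glued,
      (∀ w, (∀ (j : ι') (y : ↥(handleTube 3 2)), (g j).toFun y ≠ w) → E w = G.jN w) ∧
      (∀ (j : ι') (y : ↥(handleTube 3 2)),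
        lamSq 2 (((y : closedBall (0 : EuclideanSpace ℝ (Fin 4)) 1) : EuclideanSpace ℝ (Fin 4))) ≠ 1 →
        E ((g j).toFun y) = gluedHandleChart D (f j) G a (modelF a κ δ
          (handleInversion 2 (((y : closedBall (0 : EuclideanSpace ℝ (Fin 4)) 1) : EuclideanSpace ℝ (Fin 4)))))) := by
  classical
  let E : W → G.d₂.Glued := fun w =>
    if hw : ∃ jy : ι' × ↥(handleTube 3 2), (g jy.1).toFun jy.2 = w ∧
        lamSq 2 (((jy.2 : closedBall (0 : EuclideanSpace ℝ (Fin 4)) 1) : EuclideanSpace ℝ (Fin 4))) ≠ 1 then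
      gluedHandleChart D (f hw.choose.1) G a (modelF a κ δ
        (handleInversion 2 (((hw.choose.2 : closedBall (0 : EuclideanSpace ℝ (Fin 4)) 1) : EuclideanSpace ℝ (Fin 4)))))
    else G.jN w
  refine ⟨E, fun w hw => ?_, fun j y hy => ?_⟩
  · have hn : ¬ ∃ jy : ι' × ↥(handleTube 3 2), (g jy.1).toFun jy.2 = w ∧
        lamSq 2 (((jy.2 : closedBall (0 : EuclideanSpace ℝ (Fin 4)) 1) : EuclideanSpace ℝ (Fin 4))) ≠ 1 :=
      fun ⟨jy, he, _⟩ => hw jy.1 jy.2 he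
    simp only [E, dif_neg hn]
  · have hex : ∃ jy : ι' × ↥(handleTube 3 2), (g jy.1).toFun jy.2 = (g j).toFun y ∧
        lamSq 2 (((jy.2 : closedBall (0 : EuclideanSpace ℝ (Fin 4)) 1) : EuclideanSpace ℝ (Fin 4))) ≠ 1 :=
      ⟨(j, y), rfl, hy⟩
    simp only [E, dif_pos hex]
    obtain ⟨he, -⟩ := hex.choose_spec
    have hj : hex.choose.1 = j := index_eq_of_apply_eq hdisj he
    have hyy : hex.choose.2 = y := by
      have he' : (g j).toFun hex.choose.2 = (g j).toFun y := by
        have h2 := he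
        rw [hj] at h2
        exact h2
      exact (g j).injective he'
    rw [hj, hyy]

/-- **On the roof shells `E` is `j_N`**: for `y ∈ T` with `‖y_λ‖² < 1/4`, `E (g j y) = j_N (g j y)` (F-top:
`𝓕 (α y) = dualVec (α (α y)) = dualVec y`, and (HT)). [cite: MilnorHCobordism1965, §3] -/
theorem extension_tube_of_lt (hκ : 0 < κ) {E : W → G.d₂.Glued}
    (hE2 : ∀ (j : ι') (y : ↥(handleTube 3 2)),
      lamSq 2 (((y : closedBall (0 : EuclideanSpace ℝ (Fin 4)) 1) : EuclideanSpace ℝ (Fin 4))) ≠ 1 →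
      E ((g j).toFun y) = gluedHandleChart D (f j) G a (modelF a κ δ
        (handleInversion 2 (((y : closedBall (0 : EuclideanSpace ℝ (Fin 4)) 1) : EuclideanSpace ℝ (Fin 4))))))
    (hT : ∀ (j : ι') (y : ↥(handleTube 3 2)), gluedHandleChart D (f j) G a (dualVec a κ δ y) = G.jN ((g j).toFun y))
    (j : ι') (y : ↥(handleTube 3 2))
    (hy : lamSq 2 (((y : closedBall (0 : EuclideanSpace ℝ (Fin 4)) 1) : EuclideanSpace ℝ (Fin 4))) < 1 / 4) :
    E ((g j).toFun y) = G.jN ((g j).toFun y) := by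
  have hy1 : lamSq 2 (((y : closedBall (0 : EuclideanSpace ℝ (Fin 4)) 1) : EuclideanSpace ℝ (Fin 4))) ≠ 1 := by
    intro h1; rw [h1] at hy; norm_num at hy
  rw [hE2 j y hy1]
  obtain ⟨hx1, hxs, h0, -⟩ := tube_inv_mem y hy1
  set x := handleInversion 2 (((y : closedBall (0 : EuclideanSpace ℝ (Fin 4)) 1) : EuclideanSpace ℝ (Fin 4))) with hx
  have hs : 3 / 4 < lamSq 2 x := by rw [hxs]; linarith
  have hs1 : lamSq 2 x < 1 := by rw [hxs]; linarith
  rw [modelF_eq_dualVec_handleInversion hκ x hx1 hs hs1]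
  have hyy : handleInversionPt (⟨x, mem_closedBall_zero_iff.2 hx1⟩ : closedBall (0 : EuclideanSpace ℝ (Fin 4)) 1)
      (by show lamSq 2 x ≠ 0; linarith) (by show lamSq 2 x ≠ 1; exact ne_of_lt hs1) = y := by
    apply Subtype.ext; apply Subtype.ext
    rw [coe_coe_handleInversionPt]
    exact handleInversion_handleInversion h0 (by linarith)
  rw [hyy, hT]

/-- **`E = j_N` at every point all of whose tube coordinates are shallow** (in particular at every point
off the tubes). [cite: MilnorHCobordism1965, §3] -/
theorem extension_eq_jN_of_shallow (hκ : 0 < κ) {E : W → G.d₂.Glued}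
    (hE1 : ∀ w, (∀ (j : ι') (y : ↥(handleTube 3 2)), (g j).toFun y ≠ w) → E w = G.jN w)
    (hE2 : ∀ (j : ι') (y : ↥(handleTube 3 2)),
      lamSq 2 (((y : closedBall (0 : EuclideanSpace ℝ (Fin 4)) 1) : EuclideanSpace ℝ (Fin 4))) ≠ 1 →
      E ((g j).toFun y) = gluedHandleChart D (f j) G a (modelF a κ δ
        (handleInversion 2 (((y : closedBall (0 : EuclideanSpace ℝ (Fin 4)) 1) : EuclideanSpace ℝ (Fin 4))))))
    (hT : ∀ (j : ι') (y : ↥(handleTube 3 2)), gluedHandleChart D (f j) G a (dualVec a κ δ y) = G.jN ((g j).toFun y))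
    {w : W} (hw : ∀ (j : ι') (y : ↥(handleTube 3 2)), (g j).toFun y = w →
      lamSq 2 (((y : closedBall (0 : EuclideanSpace ℝ (Fin 4)) 1) : EuclideanSpace ℝ (Fin 4))) < 1 / 4) :
    E w = G.jN w := by
  by_cases hex : ∃ (j : ι') (y : ↥(handleTube 3 2)), (g j).toFun y = w
  · obtain ⟨j, y, rfl⟩ := hex
    exact extension_tube_of_lt D f G g hκ hE2 hT j y (hw j y rfl)
  · push Not at hex
    exact hE1 w hex

omit [IsManifold (𝓡∂ 4) ∞ W] in
/-- **The shallow set `{p | all tube coordinates of p have ‖y_λ‖² < c}` is open** (`0 < c`; its complement is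
the finite union of the compact deep ends `g j {c ≤ ‖y_λ‖²}`). [folklore] -/
theorem isOpen_shallowSet [T2Space W] [Finite ι'] {c : ℝ} (hc : 0 < c) :
    IsOpen {p : W | ∀ (j : ι') (y : ↥(handleTube 3 2)), (g j).toFun y = p →
      lamSq 2 (((y : closedBall (0 : EuclideanSpace ℝ (Fin 4)) 1) : EuclideanSpace ℝ (Fin 4))) < c} := by
  have hcl : IsClosed (⋃ j : ι', (g j).toFun '' {y : ↥(handleTube 3 2) |
      c ≤ lamSq 2 (((y : closedBall (0 : EuclideanSpace ℝ (Fin 4)) 1) : EuclideanSpace ℝ (Fin 4)))}) :=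
    isClosed_iUnion_of_finite fun j => (isCompact_image_tube_ge j hc).isClosed
  convert hcl.isOpen_compl using 1
  ext p
  simp only [mem_setOf_eq, mem_compl_iff, mem_iUnion, mem_image, not_exists, not_and]
  constructor
  · intro hp j y hy he
    exact absurd (hp j y he) (not_lt.2 hy)
  · intro hp j y he
    exact not_le.1 fun hy => hp j y hy he

omit [IsManifold (𝓡∂ 4) ∞ W] in
/-- The shallow set (`c ≤ 1`) misses the attaching circles. [folklore] -/
theorem shallowSet_subset_coresComplement [T2Space W] [Finite ι'] {c : ℝ} (hc1 : c ≤ 1) :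
    {p : W | ∀ (j : ι') (y : ↥(handleTube 3 2)), (g j).toFun y = p →
      lamSq 2 (((y : closedBall (0 : EuclideanSpace ℝ (Fin 4)) 1) : EuclideanSpace ℝ (Fin 4))) < c} ⊆
      (coresComplement g : Set W) := by
  intro p hp
  rw [SetLike.mem_coe, mem_coresComplement]
  intro j hj
  obtain ⟨y, hy, he⟩ := (mem_core_iff _).1 hj
  have := hp j y he
  linarith

/-! ### §2 `E` is an injective immersion off the attaching circles -/

variable [CompactSpace X] [T2Space X] [T2Space W]

/-- **`E` is an immersion at every point off the attaching circles** (`(𝓡∂ 4) → (𝓡 4)`): near a shallow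
point `E = j_N` (`isOpen_shallowSet`, Milnor's `j_N` is an immersion); at a tube point `g j y₀`, `y₀ ∉ S`,
the tube piece `y ↦ E (g j y) = K̃ⱼ y` is an immersion near `y₀` (file II) and `g j` is an open smooth
embedding, along which the immersion is transported. [cite: LeeSmoothManifolds2013, Prop. 5.22] -/
theorem isImmersionAt_extension [Finite ι'] (ha : 0 < a) (hCM : ∀ j, CollarAdapted D (f j) G a)
    (hκ : 0 < κ) (hκ2 : κ ≤ 1 / 2) (hδ : 0 < δ) (hδ2 : δ ≤ 1 / 2) (haδ : a * δ ≤ 1 / 5)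
    (hdisj : Pairwise fun i j => Disjoint (range (g i).toFun) (range (g j).toFun)) {E : W → G.d₂.Glued}
    (hE1 : ∀ w, (∀ (j : ι') (y : ↥(handleTube 3 2)), (g j).toFun y ≠ w) → E w = G.jN w)
    (hE2 : ∀ (j : ι') (y : ↥(handleTube 3 2)),
      lamSq 2 (((y : closedBall (0 : EuclideanSpace ℝ (Fin 4)) 1) : EuclideanSpace ℝ (Fin 4))) ≠ 1 →
      E ((g j).toFun y) = gluedHandleChart D (f j) G a (modelF a κ δ
        (handleInversion 2 (((y : closedBall (0 : EuclideanSpace ℝ (Fin 4)) 1) : EuclideanSpace ℝ (Fin 4))))))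
    (hT : ∀ (j : ι') (y : ↥(handleTube 3 2)), gluedHandleChart D (f j) G a (dualVec a κ δ y) = G.jN ((g j).toFun y))
    {w : W} (hw : w ∈ coresComplement g) :
    Manifold.IsImmersionAt (𝓡∂ 4) (𝓡 4) ∞ E w := by
  by_cases hA : ∀ (j : ι') (y : ↥(handleTube 3 2)), (g j).toFun y = w →
      lamSq 2 (((y : closedBall (0 : EuclideanSpace ℝ (Fin 4)) 1) : EuclideanSpace ℝ (Fin 4))) < 1 / 4
  · -- shallow point: `E = j_N` nearby
    refine (G.isImmersionAtOfComplement_jN w).isImmersionAt.congr_of_eventuallyEq ?_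
    filter_upwards [(isOpen_shallowSet g (by norm_num : (0 : ℝ) < 1 / 4)).mem_nhds hA] with q hq
    exact (extension_eq_jN_of_shallow D f G g hκ hE1 hE2 hT hq).symm
  · -- tube point
    push Not at hA
    obtain ⟨j, y₀, rfl, -⟩ := hA
    haveI : Nonempty ↥(handleTube 3 2) := ⟨y₀⟩
    have hy₀ : lamSq 2 (((y₀ : closedBall (0 : EuclideanSpace ℝ (Fin 4)) 1) : EuclideanSpace ℝ (Fin 4))) ≠ 1 :=
      (apply_mem_coresComplement_iff hdisj j y₀).1 hw
    set e := openEmbeddingChart (g j).isSmoothEmbedding (g j).isOpen_range with he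
    have hK : Manifold.IsImmersionAt (𝓡∂ 4) (𝓡 4) ∞ (fun y : ↥(handleTube 3 2) => E ((g j).toFun y)) y₀ := by
      refine (isImmersionAt_tubeMap D (f j) G ha (hCM j) hκ hκ2 hδ hδ2 haδ y₀ hy₀).congr_of_eventuallyEq ?_
      filter_upwards [(isOpen_ne.preimage (continuous_lamSq_handleTube 3 2)).mem_nhds hy₀] with y hy
      exact (hE2 j y hy).symm
    have hΦ : ContMDiffOn (𝓡∂ 4) (𝓡∂ 4) ∞ e.symm e.symm.source := contMDiffOn_openEmbeddingChart_symm _ _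
    have hΦ' : ContMDiffOn (𝓡∂ 4) (𝓡∂ 4) ∞ e.symm.symm e.symm.target := by
      rw [OpenPartialHomeomorph.symm_symm, OpenPartialHomeomorph.symm_target]
      exact contMDiffOn_openEmbeddingChart _ _
    have hsrc : (g j).toFun y₀ ∈ e.symm.source := by
      rw [OpenPartialHomeomorph.symm_source, he, openEmbeddingChart_target]; exact mem_range_self _
    have hey : e.symm ((g j).toFun y₀) = y₀ := openEmbeddingChart_symm_apply _ _ y₀
    have h2 : Manifold.IsImmersionAtOfComplement hK.complement (𝓡∂ 4) (𝓡 4) ∞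
        (fun y : ↥(handleTube 3 2) => E ((g j).toFun y)) (e.symm ((g j).toFun y₀)) := by
      rw [hey]; exact hK.isImmersionAtOfComplement_complement
    have h3 := (h2.comp_openPartialHomeomorph e.symm hΦ hΦ' hsrc).isImmersionAt
    refine h3.congr_of_eventuallyEq ?_
    filter_upwards [(g j).isOpen_range.mem_nhds (mem_range_self y₀)] with q hq
    show E ((g j).toFun (e.symm q)) = E q
    rw [he, apply_openEmbeddingChart_symm _ _ hq]

omit [CompactSpace X] [T2Space X] [T2Space W] in
/-- **A stretched tube point is not `j_N` of a point off the tubes**: `Θ_{f j} (𝓕 (α y)) = j_N w'` forces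
`w'` onto the `j`-th tube (`W`-side image points are dual vectors, (HT); ball image points are interior
handle points of `X`, which are not on the seam). [cite: MilnorHCobordism1965, §3] -/
theorem chart_modelF_ne_jN (ha : 0 < a) (hκ : 0 < κ) (hκ2 : κ ≤ 1 / 2) (hδ : 0 < δ) (hδ2 : δ ≤ 1 / 2)
    (haδ : a * δ ≤ 1 / 5)
    (hT : ∀ (j : ι') (y : ↥(handleTube 3 2)), gluedHandleChart D (f j) G a (dualVec a κ δ y) = G.jN ((g j).toFun y))
    (j : ι') {u : EuclideanSpace ℝ (Fin 4)} (hu1 : ‖u‖ ≤ 1) (hus : sOf u < 1) {w' : W}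
    (hw' : ∀ (j' : ι') (y' : ↥(handleTube 3 2)), (g j').toFun y' ≠ w') :
    gluedHandleChart D (f j) G a (modelF a κ δ u) ≠ G.jN w' := by
  intro heq
  obtain ⟨hmem, -⟩ := modelF_mem_chartDom ha hκ hκ2 hδ hδ2 haδ hu1 hus
  by_cases h1 : 1 ≤ ‖modelF a κ δ u‖
  · obtain ⟨y'', hy''⟩ := exists_dualVec_eq_of_one_le_norm ha hκ hκ2 hδ hδ2 hmem h1
    rw [← hy'', hT] at heq
    exact hw' j y'' (G.injective_jN heq)
  · push Not at h1
    rw [gluedHandleChart_of_norm_lt_one D (f j) G a h1] at heq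
    obtain ⟨z, hz, -⟩ := G.jM_eq_jN_iff.1 heq
    have hint := isInteriorPoint_jB D (f j) (b := beltBallPt (modelF a κ δ u)) (by rwa [coe_beltBallPt h1])
    rw [hz] at hint
    exact ((𝓡∂ 4).isInteriorPoint_iff_not_isBoundaryPoint _).1 hint (bX.incl_mem_boundary z)

omit [CompactSpace X] [T2Space X] in
/-- **`E` is injective off the attaching circles** (two tube points: disjoint charts of different
handles, injectivity of `Θ ∘ 𝓕` and of the involution `α`; tube versus non-tube: `chart_modelF_ne_jN`;
two non-tube points: `j_N` is injective). [cite: MilnorHCobordism1965, §3] -/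
theorem injOn_extension [Finite ι'] (ha : 0 < a) (hf : Injective f) (hCM : ∀ j, CollarAdapted D (f j) G a)
    (hκ : 0 < κ) (hκ2 : κ ≤ 1 / 2) (hδ : 0 < δ) (hδ2 : δ ≤ 1 / 2) (haδ : a * δ ≤ 1 / 5)
    (hdisj : Pairwise fun i j => Disjoint (range (g i).toFun) (range (g j).toFun)) {E : W → G.d₂.Glued}
    (hE1 : ∀ w, (∀ (j : ι') (y : ↥(handleTube 3 2)), (g j).toFun y ≠ w) → E w = G.jN w)
    (hE2 : ∀ (j : ι') (y : ↥(handleTube 3 2)),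
      lamSq 2 (((y : closedBall (0 : EuclideanSpace ℝ (Fin 4)) 1) : EuclideanSpace ℝ (Fin 4))) ≠ 1 →
      E ((g j).toFun y) = gluedHandleChart D (f j) G a (modelF a κ δ
        (handleInversion 2 (((y : closedBall (0 : EuclideanSpace ℝ (Fin 4)) 1) : EuclideanSpace ℝ (Fin 4))))))
    (hT : ∀ (j : ι') (y : ↥(handleTube 3 2)), gluedHandleChart D (f j) G a (dualVec a κ δ y) = G.jN ((g j).toFun y)) :
    InjOn E (coresComplement g : Set W) := by
  -- a tube point and a non-tube point have different images
  have key : ∀ (j : ι') (y : ↥(handleTube 3 2)),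
      lamSq 2 (((y : closedBall (0 : EuclideanSpace ℝ (Fin 4)) 1) : EuclideanSpace ℝ (Fin 4))) ≠ 1 →
      ∀ w', (∀ (j' : ι') (y' : ↥(handleTube 3 2)), (g j').toFun y' ≠ w') → E ((g j).toFun y) ≠ E w' := by
    intro j y hy w' hw' heq
    rw [hE2 j y hy, hE1 w' hw'] at heq
    obtain ⟨hx1, hxs, h0, hl1⟩ := tube_inv_mem y hy
    have hus : sOf (handleInversion 2 (((y : closedBall (0 : EuclideanSpace ℝ (Fin 4)) 1) : EuclideanSpace ℝ (Fin 4)))) < 1 := by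
      rw [sOf_eq_lamSq, hxs]; linarith
    exact chart_modelF_ne_jN D f G g ha hκ hκ2 hδ hδ2 haδ hT j hx1 hus hw' heq
  intro w hw w' hw' heq
  rw [SetLike.mem_coe] at hw hw'
  by_cases hex : ∃ (j : ι') (y : ↥(handleTube 3 2)), (g j).toFun y = w <;>
    by_cases hex' : ∃ (j : ι') (y : ↥(handleTube 3 2)), (g j).toFun y = w'
  · obtain ⟨j, y, rfl⟩ := hex
    obtain ⟨j', y', rfl⟩ := hex'
    have hy := (apply_mem_coresComplement_iff hdisj j y).1 hw
    have hy' := (apply_mem_coresComplement_iff hdisj j' y').1 hw'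
    rw [hE2 j y hy, hE2 j' y' hy'] at heq
    obtain ⟨hx1, hxs, h0, hl1⟩ := tube_inv_mem y hy
    obtain ⟨hx1', hxs', h0', hl1'⟩ := tube_inv_mem y' hy'
    have hus : sOf (handleInversion 2 (((y : closedBall (0 : EuclideanSpace ℝ (Fin 4)) 1) : EuclideanSpace ℝ (Fin 4)))) < 1 := by
      rw [sOf_eq_lamSq, hxs]; linarith
    have hus' : sOf (handleInversion 2 (((y' : closedBall (0 : EuclideanSpace ℝ (Fin 4)) 1) : EuclideanSpace ℝ (Fin 4)))) < 1 := by
      rw [sOf_eq_lamSq, hxs']; linarith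
    have hV := mem_compDom_of_norm_le_one ha hκ hκ2 hδ hδ2 haδ hx1 hus
    have hV' := mem_compDom_of_norm_le_one ha hκ hκ2 hδ hδ2 haδ hx1' hus'
    have hjj : f j = f j' := by
      by_contra hne
      exact gluedHandleChart_ne D G ha hne (hCM j) (hCM j') hV.2 hV'.2 heq
    have hjj' : j = j' := hf hjj
    subst hjj'
    have hαα := injOn_comp_modelF D (f j) G ha (hCM j) hκ hκ2 hδ hδ2 hV hV' heq
    have hyy : y = y' := by
      apply Subtype.ext; apply Subtype.ext
      rw [← handleInversion_handleInversion h0 hl1, hαα, handleInversion_handleInversion h0' hl1']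
    rw [hyy]
  · obtain ⟨j, y, rfl⟩ := hex
    push Not at hex'
    exact absurd heq (key j y ((apply_mem_coresComplement_iff hdisj j y).1 hw) w' hex')
  · obtain ⟨j', y', rfl⟩ := hex'
    push Not at hex
    exact absurd heq.symm (key j' y' ((apply_mem_coresComplement_iff hdisj j' y').1 hw') w hex)
  · push Not at hex hex'
    rw [hE1 w hex, hE1 w' hex'] at heq
    exact G.injective_jN heq

end Extension

/-! ### §3 The dual family has pairwise disjoint ranges -/

section DualFamily

variable {B : Type} [TopologicalSpace B] [T2Space B] [ChartedSpace (EuclideanHalfSpace 4) B]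
  {ι : Type} [Finite ι] {h : ι → HandleAttachingMap 3 2 B}
  {X : Type} [TopologicalSpace X] [ChartedSpace (EuclideanHalfSpace 4) X] [IsManifold (𝓡∂ 4) ∞ X]
  (D : MultiAttachmentData h (𝓡∂ 4) X) {ι' : Type} (f : ι' → ι) (bX : BoundaryData (𝓡∂ 4) X (𝓡 3))
  {W : Type} [TopologicalSpace W] [ChartedSpace (EuclideanHalfSpace 4) W]
  [IsManifold (𝓡∂ 4) ∞ W] (bW : BoundaryData (𝓡∂ 4) W (𝓡 3)) (Ψ : bX.carrier ≃ₘ⟮𝓡 3, 𝓡 3⟯ bW.carrier)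
  (col : (BoundaryManifold.boundaryData 3 W).Collar) {κ δ : ℝ}

/-- **The dual attaching map on points**: `dualMap … j y = col (seamDiffeo (belt tube of handle j at
(x̂_λ(y), κ x_μ(y))), δ d(y))`. [cite: MilnorHCobordism1965, §3] -/
theorem dualMap_apply (hκ : 0 < κ) (hκ1 : κ ≤ 1) (hδ : 0 < δ) (hδ2 : δ ≤ 1 / 2) (j : ι) (y : ↥(handleTube 3 2)) :
    (dualMap D bX bW Ψ col κ δ hκ hκ1 hδ hδ2 j).toFun y =
      col.toFun (seamDiffeo bX bW Ψ ((beltMap D j).boundaryTube.toHomeo (tubeAngle y, κ • tubeFibre y)),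
        Set.projIcc 0 1 zero_le_one (δ * tubeDepth y)) := by
  rw [dualMap, pushedMap, TubeAttachData.attachingMap_apply]
  show col.toFun (((beltMap D j).boundaryTube.mapDiffeo (seamDiffeo bX bW Ψ)).toHomeo (tubeAngle y, κ • tubeFibre y), _) = _
  rw [CircleTube.mapDiffeo_apply]
  rfl

/-- **The dual attaching maps of different handles have disjoint ranges** (the collar and the seam
diffeomorphism are injective, and the belt tubes of different handles are disjoint,
`pairwise_disjoint_range_beltMap`). [cite: MilnorHCobordism1965, §3] -/
theorem pairwise_disjoint_range_dualMap (hf : Injective f) (hκ : 0 < κ) (hκ1 : κ ≤ 1) (hδ : 0 < δ)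
    (hδ2 : δ ≤ 1 / 2) :
    Pairwise fun i j => Disjoint (range (dualMap D bX bW Ψ col κ δ hκ hκ1 hδ hδ2 (f i)).toFun)
      (range (dualMap D bX bW Ψ col κ δ hκ hκ1 hδ hδ2 (f j)).toFun) := by
  intro i j hij
  rw [Set.disjoint_left]
  rintro _ ⟨y, rfl⟩ ⟨y', he⟩
  rw [dualMap_apply, dualMap_apply] at he
  have h1 := (Prod.ext_iff.1 (col.injective he)).1
  have h2 := (seamDiffeo bX bW Ψ).injective h1
  have h3 := congrArg (BoundaryManifold.boundaryData 3 X).incl h2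
  have h4 : (beltMap D (f j)).toFun (depthLine (tubeAngle y') (κ • tubeFibre y') 0) =
      (beltMap D (f i)).toFun (depthLine (tubeAngle y) (κ • tubeFibre y) 0) := h3
  exact (pairwise_disjoint_range_beltMap D (hf.ne hij.symm)).ne_of_mem (mem_range_self _) (mem_range_self _) h4

end DualFamily

/-- **Registered helper `helper_exists_dualExtension` (brick T3b (iv), sub-goal of
`stub_T3_dualPresentation`, wave 5, lead c5): the stretched `W`-piece `E : W → M'` of the dual
multi-attachment data exists** — `E = Θ_{f j} ∘ 𝓕 ∘ α` on the `j`-th tube off its attaching sphere,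
`E = j_N` off the tubes (Milnor's stretch `W ∪ ∂W × I ≅ W` across the seam; it is an injective immersion
off the attaching circles, `isImmersionAt_extension`, `injOn_extension`). [cite: MilnorHCobordism1965, §3] -/
theorem helper_exists_dualExtension : ∀ {B : Type} [TopologicalSpace B] [T2Space B] [ChartedSpace (EuclideanHalfSpace 4) B] {ι : Type} [Finite ι] {h : ι → Literature.Topology.FourManifolds.HandleAttachingMap 3 2 B} {X : Type} [TopologicalSpace X] [ChartedSpace (EuclideanHalfSpace 4) X] [IsManifold (𝓡∂ 4) ∞ X] (D : Literature.Topology.FourManifolds.HandleAttachingMap.MultiAttachmentData h (𝓡∂ 4) X) {ι' : Type} (f : ι' → ι) {bX : Literature.Topology.FourManifolds.BoundaryData (𝓡∂ 4) X (𝓡 3)} {W : Type} [TopologicalSpace W] [ChartedSpace (EuclideanHalfSpace 4) W] [IsManifold (𝓡∂ 4) ∞ W] {bW : Literature.Topology.FourManifolds.BoundaryData (𝓡∂ 4) W (𝓡 3)} [Nonempty bX.carrier] (G : Literature.Topology.FourManifolds.BoundaryGlueData bX bW) {a κ δ : ℝ} (g : ι' → Literature.Topology.FourManifolds.HandleAttachingMap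 3 2 W), (Pairwise fun i j => Disjoint (Set.range (g i).toFun) (Set.range (g j).toFun)) → ∃ E : W → G.d₂.Glued, (∀ w, (∀ (j : ι') (y : ↥(Literature.Topology.FourManifolds.handleTube 3 2)), (g j).toFun y ≠ w) → E w = G.jN w) ∧ (∀ (j : ι') (y : ↥(Literature.Topology.FourManifolds.handleTube 3 2)), Literature.Topology.FourManifolds.lamSq 2 (((y : Metric.closedBall (0 : EuclideanSpace ℝ (Fin 4)) 1) : EuclideanSpace ℝ (Fin 4))) ≠ 1 → E ((g j).toFun y) = Summit.SmoothPoincare4.SmoothPoincare4.Theorems.AcyclicBisectionExists.ModpBraidOrbits.gluedHandleChart D (f j) G a (Summit.SmoothPoincare4.SmoothPoincare4.Theorems.AcyclicBisectionExists.ModpBraidOrbits.modelF a κ δ (Literature.Topology.FourManifolds.handleInversion 2 (((y : Metric.closedBall (0 : EuclideanSpace ℝ (Fin 4)) 1) : EuclideanSpace ℝ (Fin 4)))))) :=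
  by
  intro B _ _ _ ι _ h X _ _ _ D ι' f bX W _ _ _ bW _ G a κ δ g hdisj
  exact exists_extension D f G g hdisj

end Summit.SmoothPoincare4.SmoothPoincare4.Theorems.AcyclicBisectionExists.ModpBraidOrbits

end
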